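import Summits.KontsevichZagierPeriods.Zeta5Search.Barrier.ConeGammaLogCuspPeriods

/-!
# ζ(5) search — BARRIER: S-E's SIGNED SHAPE from TRANSLATE DOMINANCE along a ray (the passage «G → Φ» in the kernel)

HONEST FRAMING (cell `pub-zeta5`): systematic search; no irrationality claim unless kernel-certified. MODEL objects
under Brown–Zudilin's (28)+(30) accounting ([BZ22] = arXiv:2210.03391); nothing here is a statement about `ζ(5)`,
about `γ`, or about the cone's supremum (C2 = `BarrierC2` OPEN). The lemma S-E WITH USEFUL CONSTANTS stays
CONJECTURED: the drift constant below is the crude no-cancellation constant of `setIntegral_abs_torusN_sub_le_linear`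
(orders of magnitude above lead/lit g27's desk-note constant `4.93·σ(v)`, itself 3–20× over the `BARRIER-PLAN.md`
§2b plausibility budget), so this file is STRUCTURE — it says BY NAME what a static translate-dominance certificate at
a lattice point would buy — not a usable bound. No number of record moves; records in print UNMOVED. Prover P2 g19
(source: lead/lit g27 `SE-DESK-NOTE.md` §3(i) «(TD_A) ⇒ S-E's shape on the WHOLE ball»; plan INBOX 2026-08-26).

* **`phi30_sub_le_of_translateDominance`** — for `a` in the closed box with all 28 forms positive, a period `T`
  (`T·h_k(a) ∈ ℤ`), a displacement `δ`, and the HYPOTHESIS «translate dominance along the ray δ with constant `A`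
  up to radius `ρ_A`»: `P(η·δ) − P(0) ≤ T·A·η` for all `0 < η ≤ ρ_A` (`P = translateIntegral a T`; the desk note's
  `D(δ) ≤ A·‖v(δ)‖` restricted to one ray, `‖v‖` absorbed into `A`) — for EVERY `0 < ε` with
  `ε ≤ min(ρ′/(2T), 1/(T·Y+1), x_min/(2Y+1))` (`ρ′ = min(ρ_A, 1/(Y+1))`, `Y = shiftSize δ`) and the perturbed
  direction in the box:
  **`Φ(aOfS(s(a)+εδ)) − Φ(a) ≤ A·ε·log(1/ε) + ε·[A·(1 + |log(ρ′/T)|) + (2x_max)²·T·C₁ + 4C₁/T + 14/ρ′]`**,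
  `C₁ = 392·Y·(T·x_max + 5)/x_min` — an UPPER bound with EXPLICIT constants on the WHOLE explicit range (no
  coherence radius): the rigid translates `δ_k = εkT·δ` with frozen weights carry the `ε·log(1/ε)` (harmonic sum,
  `harmonic_le_one_add_log`), the drift / weight freezing / head / tail are `O(ε)` by part 2/3's lemmas, which
  need no Lemma B. NOT here (honest): translate dominance at ANY direction (a static finite statement about one step
  function and one closed orbit — the lane's / cert-2's (TD_A) probes are MODEL data, not kernel), any useful
  constant, anything about `γ`, C2 or `ζ(5)`.
-/

noncomputable section

open Set MeasureTheory
open scoped Topology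

namespace Summit.KontsevichZagierPeriods.Zeta5Search.Barrier.ConeGamma

/-- **S-E's signed shape from translate dominance along a ray** (lead/lit g27 `SE-DESK-NOTE.md` §3(i), kernel
form with explicit — crude — constants). See the module docstring; `ρ′ = min ρ_A (1/(Y+1))`. -/
theorem phi30_sub_le_of_translateDominance {a : Dir} (ha : BZBox a) (hpos : ∀ k, 0 < h28 a k) {T : ℝ}
    (hT : 0 < T) (hper : ∀ k : Fin 28, ∃ z : ℤ, T * h28 a k = z) (δ : Fin 8 → ℝ) {A ρA : ℝ} (hA : 0 ≤ A)
    (hρA : 0 < ρA)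
    (hTD : ∀ η, 0 < η → η ≤ ρA → translateIntegral a T (η • δ) - translateIntegral a T 0 ≤ T * A * η)
    {ε : ℝ} (hε : 0 < ε)
    (hεle : ε ≤ min (min ρA (1 / (shiftSize δ + 1)) / (2 * T))
      (min (1 / (T * shiftSize δ + 1)) (xMin a / (2 * shiftSize δ + 1))))
    (haε : BZBox (aOfS (sParam a + ε • δ))) :
    phi30 (aOfS (sParam a + ε • δ)) - phi30 a
      ≤ A * ε * Real.log (1 / ε)
        + ε * (A * (1 + |Real.log (min ρA (1 / (shiftSize δ + 1)) / T)|)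
          + (2 * xMax a) ^ 2 * T * (392 * shiftSize δ * (T * xMax a + 5) / xMin a)
          + 4 * (392 * shiftSize δ * (T * xMax a + 5) / xMin a) / T
          + 14 / min ρA (1 / (shiftSize δ + 1))) := by
  -- constants (opaque names with defining equations)
  have hY0 : 0 ≤ shiftSize δ := shiftSize_nonneg δ
  have hxm := xMin_pos hpos
  have hxM := xMax_pos hpos
  obtain ⟨C₁, hC₁⟩ : ∃ C₁ : ℝ, C₁ = 392 * shiftSize δ * (T * xMax a + 5) / xMin a := ⟨_, rfl⟩
  have hC₁nn : 0 ≤ C₁ := by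
    rw [hC₁]; exact div_nonneg (mul_nonneg (mul_nonneg (by norm_num) hY0) (by nlinarith)) hxm.le
  obtain ⟨ρ, hρdef⟩ : ∃ ρ : ℝ, ρ = min ρA (1 / (shiftSize δ + 1)) := ⟨_, rfl⟩
  have hρ : 0 < ρ := by rw [hρdef]; exact lt_min hρA (div_pos one_pos (by linarith))
  have hρA' : ρ ≤ ρA := by rw [hρdef]; exact min_le_left _ _
  have hρY : ρ * shiftSize δ ≤ 1 := by
    have h : ρ ≤ 1 / (shiftSize δ + 1) := by rw [hρdef]; exact min_le_right _ _
    rw [le_div_iff₀ (by linarith)] at h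
    nlinarith [mul_nonneg hρ.le hY0]
  rw [← hρdef] at hεle
  rw [← hρdef, ← hC₁]
  -- the three smallness conditions on ε
  have hεa : ε * T ≤ ρ / 2 := by
    have : ε ≤ ρ / (2 * T) := hεle.trans (min_le_left _ _)
    rw [le_div_iff₀ (by linarith)] at this; linarith
  have hεb : ε * T * shiftSize δ ≤ 1 := by
    have h : ε ≤ 1 / (T * shiftSize δ + 1) := hεle.trans ((min_le_right _ _).trans (min_le_left _ _))
    rw [le_div_iff₀ (by nlinarith)] at h
    nlinarith [mul_nonneg hε.le hY0, mul_nonneg (mul_nonneg hε.le hT.le) hY0]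
  have hεc : ε * shiftSize δ ≤ xMin a / 2 := by
    have h : ε ≤ xMin a / (2 * shiftSize δ + 1) := hεle.trans ((min_le_right _ _).trans (min_le_right _ _))
    rw [le_div_iff₀ (by linarith)] at h
    nlinarith [mul_nonneg hε.le hY0]
  -- the number of periods below the dominance radius
  obtain ⟨K, hK⟩ : ∃ K : ℕ, K = ⌊ρ / (ε * T)⌋₊ := ⟨_, rfl⟩
  have hεT : 0 < ε * T := mul_pos hε hT
  have hx2 : (2 : ℝ) ≤ ρ / (ε * T) := by rw [le_div_iff₀ hεT]; linarith
  have hK2 : 2 ≤ K := by rw [hK]; exact Nat.le_floor (by exact_mod_cast hx2)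
  have hK2r : (2 : ℝ) ≤ K := by exact_mod_cast hK2
  have hKle : (K : ℝ) ≤ ρ / (ε * T) := by rw [hK]; exact Nat.floor_le (div_nonneg hρ.le hεT.le)
  have hKge : ρ / (ε * T) - 1 ≤ K := by
    have := Nat.lt_floor_add_one (ρ / (ε * T)); rw [← hK] at this; linarith
  have hKT : 0 < (K : ℝ) * T := mul_pos (by linarith) hT
  have hεKT : ε * (K * T) ≤ ρ := by
    have := mul_le_mul_of_nonneg_left hKle hεT.le
    rw [mul_div_cancel₀ _ hεT.ne'] at this; linarith
  -- the integrand in torus form and its integrability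
  obtain ⟨g, hg⟩ : ∃ g : ℝ → ℝ,
      g = fun u => ((torusN (u • sParam a + (u * ε) • δ) : ℝ) - torusN (u • sParam a)) / u ^ 2 := ⟨_, rfl⟩
  have hpert : ∀ u : ℝ, savingN (aOfS (sParam a + ε • δ)) u = torusN (u • sParam a + (u * ε) • δ) := by
    intro u; rw [savingN_eq_torusN_of_BZBox haε, sParam_aOfS, smul_add, smul_smul]
  have hF : phi30 (aOfS (sParam a + ε • δ)) - phi30 a = ∫ u in Ioi 0, g u := by
    unfold phi30
    rw [← integral_sub (integrableOn_savingN_div_sq haε) (integrableOn_savingN_div_sq ha)]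
    refine setIntegral_congr_fun measurableSet_Ioi fun u _ => ?_
    simp only [hg, hpert u, savingN_eq_torusN_of_BZBox ha, sub_div]
  have hgint : IntegrableOn g (Ioi 0) := by
    have h := (integrableOn_savingN_div_sq haε).sub (integrableOn_savingN_div_sq ha)
    refine h.congr_fun (fun u _ => ?_) measurableSet_Ioi
    simp only [hg, Pi.sub_apply, hpert u, savingN_eq_torusN_of_BZBox ha, sub_div]
  -- split `(0, ∞) = (0, KT] ∪ (KT, ∞)` and `(0, KT]` into periods
  have hsplit : ∫ u in Ioi 0, g u = (∫ u in (0 : ℝ)..(K * T), g u) + ∫ u in Ioi (K * T), g u := by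
    rw [← Ioc_union_Ioi_eq_Ioi hKT.le, setIntegral_union Ioc_disjoint_Ioi_same measurableSet_Ioi
      (hgint.mono_set Ioc_subset_Ioi_self) (hgint.mono_set (Ioi_subset_Ioi hKT.le)),
      intervalIntegral.integral_of_le hKT.le]
  have hperiods : ∫ u in (0 : ℝ)..(K * T), g u
      = ∑ k ∈ Finset.range K, ∫ u in ((k : ℝ) * T)..(((k : ℝ) + 1) * T), g u := by
    have h := intervalIntegral.sum_integral_adjacent_intervals (a := fun k : ℕ => (k : ℝ) * T) (n := K)
      (f := g) (μ := volume) fun k _ => ?_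
    · simp only [Nat.cast_zero, zero_mul] at h
      rw [← h]
      refine Finset.sum_congr rfl fun k _ => ?_
      push_cast; rfl
    · have hk0 : (0 : ℝ) ≤ k * T := mul_nonneg (Nat.cast_nonneg k) hT.le
      rw [intervalIntegrable_iff_integrableOn_Ioc_of_le (by push_cast; nlinarith)]
      exact hgint.mono_set fun u hu => lt_of_le_of_lt hk0 hu.1
  obtain ⟨K', hK'⟩ : ∃ K', K = K' + 1 := ⟨K - 1, by omega⟩
  have hsumsplit : ∑ k ∈ Finset.range K, (∫ u in ((k : ℝ) * T)..(((k : ℝ) + 1) * T), g u)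
      = (∑ j ∈ Finset.range K', ∫ u in (((j : ℝ) + 1) * T)..(((j : ℝ) + 1 + 1) * T), g u)
        + ∫ u in (0 : ℝ)..T, g u := by
    rw [hK', Finset.sum_range_succ']
    simp only [Nat.cast_add, Nat.cast_one, Nat.cast_zero, zero_mul, zero_add, one_mul]
  -- (i) the head
  have hhead : |∫ u in (0 : ℝ)..T, g u| ≤ (2 * xMax a) ^ 2 * ((ε * T) * C₁) := by
    rw [hg, hC₁]
    exact abs_head_integral_le hpos hT δ hε.le hεb hεc
  -- (ii) each period below the dominance radius: translate dominance + the two first-moment errors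
  have hP : ∀ j : ℕ, j < K' →
      (∫ u in (((j : ℝ) + 1) * T)..(((j : ℝ) + 1 + 1) * T), g u)
        ≤ A * ε * (1 / ((j : ℝ) + 1)) + (ε * C₁ / T) * (4 / (((j : ℝ) + 1) * ((j : ℝ) + 1 + 1))) := by
    intro j hj
    have hjK : (j : ℝ) + 1 ≤ K := by
      have hj' : (j : ℝ) + 1 ≤ K' := by exact_mod_cast hj
      rw [hK']; push_cast; linarith only [hj']
    have hj1 : ((j : ℝ) + 1) * T ≤ K * T := mul_le_mul_of_nonneg_right hjK hT.le
    have hj0 : (0 : ℝ) < (j : ℝ) + 1 := Nat.cast_add_one_pos j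
    have hρ'pos : 0 < ε * (((j : ℝ) + 1) * T) := mul_pos hε (mul_pos hj0 hT)
    have hρ'le : ε * (((j : ℝ) + 1) * T) ≤ ρ := (mul_le_mul_of_nonneg_left hj1 hε.le).trans hεKT
    have hkY : ε * (((j : ℝ) + 1) * T) * shiftSize δ ≤ 1 :=
      (mul_le_mul_of_nonneg_right hρ'le hY0).trans hρY
    have hper_k := abs_period_integral_sub_translate_le hpos hT hper δ hε.le hεb (k := j + 1) (by omega)
      (by push_cast; exact hkY)
    push_cast at hper_k
    have hjnn : (0 : ℝ) ≤ (j : ℝ) := Nat.cast_nonneg j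
    have herr := (abs_le.mp (hper_k.trans (period_error_le hε.le hT (hC₁ ▸ hC₁nn)
      (by linarith only [hjnn])))).2
    -- translate dominance at `η = ε (j+1) T ≤ ρ ≤ ρ_A`
    have hdom : (translateIntegral a T ((ε * (((j : ℝ) + 1) * T)) • δ) - translateIntegral a T 0)
        / (((j : ℝ) + 1) * T) ^ 2 ≤ A * ε * (1 / ((j : ℝ) + 1)) := by
      have h := hTD _ hρ'pos (hρ'le.trans hρA')
      have hpos2 : 0 < (((j : ℝ) + 1) * T) ^ 2 := by positivity
      calc _ ≤ T * A * (ε * (((j : ℝ) + 1) * T)) / (((j : ℝ) + 1) * T) ^ 2 :=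
            div_le_div_of_nonneg_right h hpos2.le
        _ = A * ε * (1 / ((j : ℝ) + 1)) := by field_simp
    rw [hg, hC₁]
    linarith only [herr, hdom]
  -- (iii) the sum over the periods against the harmonic number
  have hsum : (∑ j ∈ Finset.range K', ∫ u in (((j : ℝ) + 1) * T)..(((j : ℝ) + 1 + 1) * T), g u)
      ≤ A * ε * ((harmonic K' : ℚ) : ℝ) + 4 * (ε * C₁ / T) := by
    have hterm := Finset.sum_le_sum fun j hj => hP j (Finset.mem_range.mp hj)
    refine hterm.trans ?_
    rw [Finset.sum_add_distrib, ← Finset.mul_sum, ← Finset.mul_sum, harmonic_cast_eq_sum]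
    have h4 : ∑ j ∈ Finset.range K', 4 / (((j : ℝ) + 1) * ((j : ℝ) + 1 + 1))
        = 4 * ∑ j ∈ Finset.range K', 1 / (((j : ℝ) + 1) * ((j : ℝ) + 2)) := by
      rw [Finset.mul_sum]
      refine Finset.sum_congr rfl fun j _ => ?_
      rw [show (j : ℝ) + 1 + 1 = (j : ℝ) + 2 by ring]
      field_simp
    rw [h4]
    have hs := sum_range_inv_mul_succ_le_one K'
    have hpos' : 0 ≤ ε * C₁ / T := div_nonneg (mul_nonneg hε.le hC₁nn) hT.le
    have := mul_le_mul_of_nonneg_left hs hpos'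
    linarith only [this]
  -- (iv) the tail
  have htail : |∫ u in Ioi ((K : ℝ) * T), g u| ≤ 14 * ε / ρ := by
    rw [hg]
    refine (abs_tail_integral_le a δ ε hKT).trans ?_
    have hKT2 : ρ / (2 * ε) ≤ K * T := by
      have h : ρ / (ε * T) / 2 ≤ K := by linarith only [hKge, hx2]
      have := mul_le_mul_of_nonneg_right h hT.le
      calc ρ / (2 * ε) = ρ / (ε * T) / 2 * T := by field_simp
        _ ≤ K * T := this
    calc 7 / ((K : ℝ) * T) ≤ 7 / (ρ / (2 * ε)) :=
          div_le_div_of_nonneg_left (by norm_num) (div_pos hρ (by linarith only [hε])) hKT2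
      _ = 14 * ε / ρ := by field_simp; ring
  -- (v) harmonic number against `log (1/ε)` (upper side only)
  have hlog : ((harmonic K' : ℚ) : ℝ) ≤ 1 + Real.log (1 / ε) + |Real.log (ρ / T)| := by
    have hKK : K - 1 = K' := by omega
    obtain ⟨-, hu⟩ := log_le_harmonic_pred_le hK2
    rw [hKK] at hu
    have hKpos : (0 : ℝ) < K := by linarith only [hK2r]
    have hlogK_le : Real.log K ≤ Real.log (1 / ε) + Real.log (ρ / T) := by
      have h := Real.log_le_log hKpos hKle
      rw [Real.log_div hρ.ne' hεT.ne', Real.log_mul hε.ne' hT.ne'] at h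
      rw [Real.log_div one_ne_zero hε.ne', Real.log_one, Real.log_div hρ.ne' hT.ne']
      linarith only [h]
    have h := le_abs_self (Real.log (ρ / T))
    linarith only [hu, hlogK_le, h]
  -- (vi) assemble
  have key : ∀ I₀ S Tl H : ℝ, |I₀| ≤ (2 * xMax a) ^ 2 * ((ε * T) * C₁) →
      S ≤ A * ε * H + 4 * (ε * C₁ / T) → |Tl| ≤ 14 * ε / ρ → H ≤ 1 + Real.log (1 / ε) + |Real.log (ρ / T)| →
      S + I₀ + Tl ≤ A * ε * Real.log (1 / ε)
        + ε * (A * (1 + |Real.log (ρ / T)|) + (2 * xMax a) ^ 2 * T * C₁ + 4 * C₁ / T + 14 / ρ) := by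
    intro I₀ S Tl H hI hS hTl hH
    have hI' := (abs_le.mp hI).2
    have hTl' := (abs_le.mp hTl).2
    have hAε : 0 ≤ A * ε := mul_nonneg hA hε.le
    have hH' := mul_le_mul_of_nonneg_left hH hAε
    have : A * ε * (1 + Real.log (1 / ε) + |Real.log (ρ / T)|) + 4 * (ε * C₁ / T)
        + (2 * xMax a) ^ 2 * ((ε * T) * C₁) + 14 * ε / ρ
        = A * ε * Real.log (1 / ε)
          + ε * (A * (1 + |Real.log (ρ / T)|) + (2 * xMax a) ^ 2 * T * C₁ + 4 * C₁ / T + 14 / ρ) := by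
      field_simp; ring
    linarith only [hI', hS, hTl', hH', this]
  rw [hF, hsplit, hperiods, hsumsplit]
  exact key (∫ u in (0 : ℝ)..T, g u)
    (∑ j ∈ Finset.range K', ∫ u in (((j : ℝ) + 1) * T)..(((j : ℝ) + 1 + 1) * T), g u)
    (∫ u in Ioi ((K : ℝ) * T), g u) ((harmonic K' : ℚ) : ℝ) hhead hsum htail hlog

end Summit.KontsevichZagierPeriods.Zeta5Search.Barrier.ConeGamma

end
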